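import Literature.MathematicalPhysics.QuantumFieldTheory.Balaban1983to89.Node00.Record9
import Literature.MathematicalPhysics.QuantumFieldTheory.Balaban1983to89.Node00.ChartOfRecord
import Summits.QuantumFields.YangMills.Theorems.BalabanUVNodesN28ZeroChart

/-!
# BalabanUVNodes ∕ N28 — binder B6 «`0 < β̄`, `0 < γc`» AT NODE 00's STAGE-9 RECORD `IsRecordOfRecord₉C` (and at the charted
# Stage-8 record `IsRecordOfRecord₈X`): where N28's two side conditions live once the chart clause of record has entered
# admissibility (chair R448), and the `N = 1` census (Track A, DAG node N28 of 28; count-neutral)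

HONEST FRAMING.  Count-neutral kernel bookkeeping; NOT a node discharge, not an estimate, nothing of Bałaban's β asserted or
refuted.  N28 is VACATED in the discharge form of record and «closes with B3» (N25 = NODE O).  RIDER OF RECORD №6 (β-VERSION,
director-ym LINE №44; dag-lead DEDUP №21's sentence for the table): β here = `Node00.betaOfRecord₉ = Node00.betaOfRecord₈ ∘ toStage8Params`,
an `rnDeriv`-REPRESENTATIVE reading (Bałaban's (1.20)–(1.22) Hessian read through the Radon–Nikodym-representative version of the
transported density); NO β-side binder (B3 ∕ B4 ∕ B6) is booked at Stage 9 over it; the version repair (a pointwise-determined `𝐓ρ_k`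
density) rides in a successor re-point — `Record10` per LINE №44 ∕ plan (pub-ymgap INBOX l.10917), or node00-def-T's INTENT-4 `betaOfRecord₉c`
(`Node00/ContinuousTransportOfRecord.lean`, continuous versions, INBOX l.10987).  Every lemma of §2–§3 below is a READING of N28's two faces
at that β, and re-points verbatim when `βfun` is re-pointed (the statements only use `βfun_datumOfRecord₉`).  The Stage-9
record class is NOT junk-inhabited (its datum exists only under the displayed `Stage9Params.Provisos`; inhabitation is the
analytic item K0) — so nothing here is a census at a cheap inhabitant EXCEPT §4, which holds at EVERY charted record with `N = 1`.

WHAT IS NEW AT STAGE 9 FOR N28 (node00-def-T's `Node00/Record9.lean`, p420804): `Stage9Params.Admissible θ` CONJOINS the chart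
clause of record `θ.toStage8Params.IsChartOfRecord θ.cβ` with `0 < θ.cβ` (dag-n23-b's `Node00/Record8Chart.lean`; chair R448:
«chart predicate of record»).  Consequences, by name:

* §1 THE PREDICATE NOW IMPLIES B6's NECESSARY-CONDITION SHADOW.  At admissible Stage-9 parameters with `2 ≤ N` the β-layer's chart
  is not the zero map (`rho8_ne_zero_of_admissible₉`) — at Stage 8 this was CERTIFIED BY N28's `0 < β̄` read at the same witness
  (`N28ZeroChart.rho8_ne_zero_of_betaPertHyp`), at Stage 9 it is IMPLIED BY ADMISSIBILITY (referee dag-ref-D READ #55: «the ₉ chart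
  clause should IMPLY it, not be implied by it» — it does).  The Stage-9 datum's β-functions ARE the Stage-8 datum's at
  `θ.toStage8Params` (`βfun_datumOfRecord₉_eq_stage8`, `rfl` — although the two data are different `FiniteEpsData` terms, Record9 §7),
  which transports every landed Stage-8 reading of N28; the window `0 < w.γ ≤ θ.γ` and the chart of a Stage-9 record
  (`exists_window_of_isRecordOfRecord₉C`, `exists_chart_of_isRecordOfRecord₉C`).
* §2 N28's `γc`-HALF AT STAGE 9: (B4) with `0 < γc` for the Stage-9 datum from joint continuity of the merged β of record on the
  binding world's OWN box, witness `γc := w.γ` (`b4_with_sideCondition_record₉_window`, converse `betaContH_merged₉_of_b4_window`,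
  existential form `exists_b4_of_isRecordOfRecord₉C_window`) — hypotheses displayed, not asserted.
* §3 N28's `β̄`-HALF AT STAGE 9 (RIDER №6 label): the one-loop numbers every NODE-O road reads at a Stage-9 datum are
  `beta0OfMerged βm₈(θ.toStage8Params) θ.v₀` BY NAME (`oneLoopSplit_β0_record₉`); the control-rule-v0.29 shape «uniform AF bound on a
  box containing `θ.v₀` + named limit existence ⇒ `0 < b ≤ β⁰_k`» (`beta0_record₉_pos_of_betaLowerH`); the literal (B3) is rigid
  (`beta0_record₉_eq_betabar_of_literalB3`); the packaged literal pair `BetaPertHyp` at the datum ↔ at the merged β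
  (`betaPertHyp_record₉_iff`, `betaPertHyp_of_isRecordOfRecord₉C`).
* §4 THE `N = 1` CENSUS (chair R448 (1): «wherever a [B12] Thm-2 clause is read the claim carries `2 ≤ N`» — theorem-backed for
  B6 ∕ B3 at EVERY CHARTED record).  𝔰𝔲(1) = 0, so at `N = 1` every chart of record is the zero chart and the β of record vanishes
  GENUINELY (dag-n23-b's `IsChartOfRecord.betaOfRecord₈_eq_zeroHBeta_of_one`): at every `SU(1)` record of `IsRecordOfRecord₈X` (hence of
  the charted-by-definition twin `IsRecordOfRecord₈R` of `Node00/ChartOfRecord.lean`) and of `IsRecordOfRecord₉C` the datum's β-functions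
  are `zeroHBeta` (`βfun_eq_zeroHBeta_of_isRecordOfRecord₈X_one` ∕ `…₈R_one` ∕ `…₉C_one`), hence
  N28's `γc`-half HOLDS and N28's `0 < β̄` FAILS in every currency (`b6Census_of_isRecordOfRecord₈X_one` ∕ `…₉C_one`: (B4) on every
  box, the literal package minus `0 < β̄` holds, every one-loop number is `0`, `BetaAFH` and `BetaPertHyp` fail), and the `∃`-FORM
  over the charted predicate that R448 (3) makes countable is itself FALSE at `N = 1`
  (`not_exists_isRecordOfRecord₈X_betaPertHyp_one`, `not_exists_isRecordOfRecord₉C_betaPertHyp_one`) — the clause `2 ≤ N` is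
  load-bearing for any β-side `∃`-claim, not a stylistic caveat.
Elementary throughout (every Stage-9 fact is the landed Stage-8 fact at `θ.toStage8Params`); `θ` a PARAMETER; 0 `def`, 0 `sorry`,
standard axioms.  Sources: T. Bałaban, CMP **109** (1987) 249–301 [Balaban1987RG1] (1.20)–(1.22) p. 264, (2.12)–(2.14) p. 268,
Thm 2 (0.31) p. 259; CMP **122** (1989) 355–392 [Balaban1989LargeFieldII] Thm 1 p. 355; B. C. Hall, *Lie Groups, Lie Algebras, and
Representations* (2015) Example 7.3 (𝔰𝔲(1) = 0).  One finite four-torus programme at fixed `ε`; nothing continuum ∕ ℝ⁴ ∕ OS ∕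
mass-gap ∕ Clay.
-/

namespace Summit.QuantumFields.YangMills.BalabanUVNodes.N28AtRecord9

open Literature.MathematicalPhysics.QuantumFieldTheory.Balaban1983to89
open Literature.MathematicalPhysics.QuantumFieldTheory.Balaban1983to89.FlowStep
open Literature.MathematicalPhysics.QuantumFieldTheory.Balaban1983to89.Node00
open Literature.MathematicalPhysics.QuantumFieldTheory.Balaban1983to89.T4Continuum (T4Family BetaPertHyp FiniteEpsData)
open Literature.MathematicalPhysics.QuantumFieldTheory.Balaban1983to89.T4FiniteEpsInhabited (zeroHBeta)
open Literature.MathematicalPhysics.QuantumFieldTheory.Balaban1983to89.DagBinding (WorldP)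
open Literature.MathematicalPhysics.QuantumFieldTheory.Balaban1983to89.BetaPertRigid (RemainderVanishes)
open Summit.QuantumFields.YangMills.BalabanUVNodes.N28AtRecord8
open Summit.QuantumFields.YangMills.BalabanUVNodes.N28ZeroChart
open Filter Topology
open scoped Matrix.Norms.L2Operator

variable {F : T4Family} {N : ℕ} [NeZero N]

/-! ## §1 What Stage-9 admissibility gives N28, by name -/

/-- **AT STAGE 9 THE PREDICATE IMPLIES B6's NECESSARY-CONDITION SHADOW.**  At admissible Stage-9 parameters with `2 ≤ N` the
β-layer's chart `θ.ρ8` is not the zero map: admissibility carries the chart clause of record with `0 < θ.cβ`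
(`Stage9Params.Admissible.chart`) and a chart of 𝔰𝔲(N), `N ≥ 2`, is non-zero (`IsChartOfRecord.rho8_ne_zero`).  At Stage 8 the same
conclusion needed N28's `0 < β̄` read at the witness (`N28ZeroChart.rho8_ne_zero_of_betaPertHyp`). [cite: Balaban1987RG1, (1.20)–(1.21) p.264] -/
theorem rho8_ne_zero_of_admissible₉ {θ : Stage9Params F N} (hθ : θ.Admissible) (hN : 2 ≤ N) :
    (letI := θ.instVβ₁; letI := θ.instVβ₂; θ.ρ8) ≠ 0 :=
  hθ.chart.2.rho8_ne_zero hθ.chart.1 hN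

/-- **The Stage-9 datum's β-functions ARE the Stage-8 datum's at `θ.toStage8Params`** (`rfl`: both are `betaOfRecord₈ θ.toStage8Params`;
the two data differ as `FiniteEpsData` terms — the represented tower's `eval (Tstep rep_k)` versus the Stage-5 `rnTransport` recursion — but
not in the field `βfun`).  This is
the bridge by which every landed Stage-8 reading of N28 transports to Stage 9. [cite: Balaban1987RG1, (1.20)–(1.22) p.264 (bookkeeping)] -/
theorem βfun_datumOfRecord₉_eq_stage8 (θ : Stage9Params F N) (h : θ.Provisos) :
    (datumOfRecord₉ F N θ h).βfun = (datumOfRecord₅ F N (θ.toStage8Params.toStage5 F N)).βfun := rfl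

/-- At admissible Stage-9 parameters the record box side is positive, `0 < θ.γ` (def-T's `Admissible.gamma_pos`, restated in N28's
words: the β of record is never the constant family of its one-loop numbers by an empty box). [cite: Balaban1989LargeFieldII, Thm 1 p.355] -/
theorem gamma_pos_of_admissible₉ {θ : Stage9Params F N} (hθ : θ.Admissible) : 0 < θ.γ := hθ.gamma_pos

/-- **THE WINDOW OF A STAGE-9 RECORD.**  At a Stage-9 record the binding world's window is positive and inside the record box,
`0 < w.γ ≤ θ.γ`, for witnessing parameters `θ` (with their provisos) whose Stage-8 β of record IS the datum's.
[cite: Balaban1989LargeFieldII, Thm 1 p.355] -/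
theorem exists_window_of_isRecordOfRecord₉C {D : FiniteEpsData F (SU N)} {w : WorldP} (h : IsRecordOfRecord₉C F N D w) :
    ∃ (θ : Stage9Params F N) (hP : θ.Provisos), θ.Admissible ∧ D = datumOfRecord₉ F N θ hP ∧
      D.βfun = betaOfRecord₈ F N θ.toStage8Params ∧ 0 < w.γ ∧ w.γ ≤ θ.γ ∧ 0 < θ.γ := by
  obtain ⟨θ, hP, hθ, hD, -, ⟨hγ0, hγle⟩, -, -⟩ := h
  subst hD
  exact ⟨θ, hP, hθ, rfl, βfun_datumOfRecord₉ F N θ hP, hγ0, hγle, hθ.gamma_pos⟩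

/-- **WHAT A STAGE-9 RECORD's β IS, WITH ITS CHART** (`2 ≤ N`): `betaOfRecord₈ θ.toStage8Params` at admissible parameters whose chart is of
record with constant `0 < θ.cβ` and NON-ZERO — the Stage-9 twin of dag-n23-b's `exists_chart_of_isRecordOfRecord₈X`.
[cite: Balaban1987RG1, (1.20)–(1.22) p.264 (bookkeeping)] -/
theorem exists_chart_of_isRecordOfRecord₉C {D : FiniteEpsData F (SU N)} {w : WorldP} (h : IsRecordOfRecord₉C F N D w) (hN : 2 ≤ N) :
    ∃ (θ : Stage9Params F N) (hP : θ.Provisos), θ.Admissible ∧ D = datumOfRecord₉ F N θ hP ∧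
      D.βfun = betaOfRecord₈ F N θ.toStage8Params ∧ 0 < θ.cβ ∧ θ.toStage8Params.IsChartOfRecord θ.cβ ∧
      (letI := θ.instVβ₁; letI := θ.instVβ₂; θ.ρ8) ≠ 0 := by
  obtain ⟨θ, hP, hθ, hD, -⟩ := h
  subst hD
  exact ⟨θ, hP, hθ, rfl, βfun_datumOfRecord₉ F N θ hP, hθ.chart.1, hθ.chart.2, rho8_ne_zero_of_admissible₉ hθ hN⟩

/-! ## §2 N28's `γc`-half at a Stage-9 record -/

/-- **(B4) WITH N28's SIDE CONDITION AT A STAGE-9 DATUM, from the world's own box.**  For Stage-9 parameters `θ` (with provisos) and a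
world obeying the record's γ-clause `0 < w.γ ≤ θ.γ`: joint continuity of the merged β of record on the binding world's box
`]0, w.γ]^{k+1}` gives (B4) for the Stage-9 datum with `γc := w.γ`.  Hypothesis displayed, not asserted ([I] §1 p. 264 ∕ NODE O's (D4)
chain supplies it). [cite: Balaban1989LargeFieldII, Thm 1 p.355] -/
theorem b4_with_sideCondition_record₉_window (θ : Stage9Params F N) (hP : θ.Provisos) (w : WorldP) (hw : 0 < w.γ ∧ w.γ ≤ θ.γ)
    (hC : letI := θ.instVβ₁; letI := θ.instVβ₂; letI := θ.instιβ
      BetaContH w.γ (betaMerged F (mergedTermFamilyMat F N (chi7 F N θ.toStage8Params) θ.εbg) θ.ρ8 θ.bV)) :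
    0 < w.γ ∧ BetaContH w.γ (datumOfRecord₉ F N θ hP).βfun := by
  rw [βfun_datumOfRecord₉_eq_stage8]
  exact b4_with_sideCondition_record₈_window θ.toStage8Params w hw hC

/-- … and conversely: (B4) for the Stage-9 datum on a window `w.γ ≤ θ.γ` GIVES the merged-β continuity on that window — the window
slot is realiser-independent (it reads `D.βfun` only). [cite: Balaban1987RG1, §1 p.264] -/
theorem betaContH_merged₉_of_b4_window (θ : Stage9Params F N) (hP : θ.Provisos) (w : WorldP) (hle : w.γ ≤ θ.γ)
    (hC : BetaContH w.γ (datumOfRecord₉ F N θ hP).βfun) :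
    letI := θ.instVβ₁; letI := θ.instVβ₂; letI := θ.instιβ
    BetaContH w.γ (betaMerged F (mergedTermFamilyMat F N (chi7 F N θ.toStage8Params) θ.εbg) θ.ρ8 θ.bV) := by
  rw [βfun_datumOfRecord₉_eq_stage8] at hC
  exact betaContH_merged₈_of_b4_window θ.toStage8Params w hle hC

/-- **(B4) WITH `0 < γc` AT A STAGE-9 RECORD, window form.**  If at every admissible Stage-9 parameter (with provisos) whose datum is
`D` and whose record box contains the world's window the merged β of record is jointly continuous on the WORLD's box
`]0, w.γ]^{k+1}`, then `(D, w)` satisfies binder (B4) with N28's side condition — witness `γc := w.γ`.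
[cite: Balaban1989LargeFieldII, Thm 1 p.355] -/
theorem exists_b4_of_isRecordOfRecord₉C_window {D : FiniteEpsData F (SU N)} {w : WorldP} (h : IsRecordOfRecord₉C F N D w)
    (hC : ∀ (θ : Stage9Params F N) (hP : θ.Provisos), θ.Admissible → D = datumOfRecord₉ F N θ hP → w.γ ≤ θ.γ →
      letI := θ.instVβ₁; letI := θ.instVβ₂; letI := θ.instιβ
      BetaContH w.γ (betaMerged F (mergedTermFamilyMat F N (chi7 F N θ.toStage8Params) θ.εbg) θ.ρ8 θ.bV)) :
    ∃ γc : ℝ, 0 < γc ∧ BetaContH γc D.βfun := by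
  obtain ⟨θ, hP, hθ, hD, -, hw, -, -⟩ := h
  subst hD
  exact ⟨w.γ, b4_with_sideCondition_record₉_window θ hP w hw (hC θ hP hθ rfl hw.2)⟩

/-! ## §3 N28's `β̄`-half at a Stage-9 record (RIDER №6: over the β of record AS LANDED; nothing booked over it) -/

/-- **THE ONE-LOOP NUMBERS A NODE-O ROAD READS AT A STAGE-9 DATUM ARE `beta0OfMerged … θ.v₀` BY NAME**: for every one-loop split
`Sβ` of the Stage-9 datum's β-functions, `Sβ.β0 k` is the `limUnder (𝓝[>] 0)` object of `Node00/BetaOfRecord.lean` at the merged β of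
record of `θ.toStage8Params` and the reference histories `θ.v₀`.  So N28's `β̄`-half in the END currencies is a statement about THAT
named object. [cite: Balaban1987RG1, (2.12)–(2.14) p.268] -/
theorem oneLoopSplit_β0_record₉ (θ : Stage9Params F N) (hP : θ.Provisos)
    (S : B12Beta.OneLoopSplit (datumOfRecord₉ F N θ hP).βfun) (k : ℕ) :
    letI := θ.instVβ₁; letI := θ.instVβ₂; letI := θ.instιβ
    S.β0 k = beta0OfMerged (betaMerged F (mergedTermFamilyMat F N (chi7 F N θ.toStage8Params) θ.εbg) θ.ρ8 θ.bV) θ.v₀ k :=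
  oneLoopSplit_β0_record₈ θ.toStage8Params S k

/-- **N28's `β̄` BECOMES (AF-0) OF THE ONE-LOOP NUMBERS OF RECORD — control rule v0.29's shape at Stage 9.**  A uniform
asymptotic-freedom bound `0 < b ≤ D.βfun` for the Stage-9 datum on a box `]0,γ']^{k+1}` inside the record box (`γ' ≤ θ.γ`) whose
interior contains the reference histories `θ.v₀`, together with the NAMED existence of the one-sided limits, gives `0 < b ≤ β⁰_k` for
EVERY `k`.  Hypotheses, not facts ([Balaban1989LargeFieldII] p. 355 «has not been published yet»); by §4 the hypothesis `hlo` is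
UNSATISFIABLE at `N = 1`. [cite: Balaban1989LargeFieldII, Thm 1 p.355] -/
theorem beta0_record₉_pos_of_betaLowerH (θ : Stage9Params F N) (hP : θ.Provisos)
    (hlim : letI := θ.instVβ₁; letI := θ.instVβ₂; letI := θ.instιβ
      Beta0LimitExists (betaMerged F (mergedTermFamilyMat F N (chi7 F N θ.toStage8Params) θ.εbg) θ.ρ8 θ.bV) θ.v₀)
    {b γ' : ℝ} (hγ' : 0 < γ') (hγ : γ' ≤ θ.γ) (hb : 0 < b)
    (hv₀ : ∀ k (i : Fin (k + 1)), i ≠ Fin.last k → 0 < θ.v₀ k i ∧ θ.v₀ k i ≤ γ')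
    (hlo : BetaLowerH b γ' (datumOfRecord₉ F N θ hP).βfun) (k : ℕ) :
    letI := θ.instVβ₁; letI := θ.instVβ₂; letI := θ.instιβ
    0 < beta0OfMerged (betaMerged F (mergedTermFamilyMat F N (chi7 F N θ.toStage8Params) θ.εbg) θ.ρ8 θ.bV) θ.v₀ k ∧
      b ≤ beta0OfMerged (betaMerged F (mergedTermFamilyMat F N (chi7 F N θ.toStage8Params) θ.εbg) θ.ρ8 θ.bV) θ.v₀ k := by
  rw [βfun_datumOfRecord₉_eq_stage8] at hlo
  exact beta0_record₈_pos_of_betaLowerH θ.toStage8Params hlim hγ' hγ hb hv₀ hlo k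

/-- **THE LITERAL (B3) AT A STAGE-9 DATUM IS RIGID.**  If the remainder of a (hence THE) one-loop split of the Stage-9 datum's β
vanishes along the diagonal as `g → 0⁺` and the LITERAL binder (B3) `BetaPertH D.βfun β̄` holds, then every one-loop number of record
equals `β̄` — which is why the literal (B3) is superseded by `DagBinding.EndpointExistence` and N28 is VACATED with it.
[cite: Balaban1989LargeFieldII, Thm 1 p.355] -/
theorem beta0_record₉_eq_betabar_of_literalB3 (θ : Stage9Params F N) (hP : θ.Provisos)
    (S : B12Beta.OneLoopSplit (datumOfRecord₉ F N θ hP).βfun) (hrem : RemainderVanishes S) {βbar : ℝ}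
    (hB3 : BetaPertH (datumOfRecord₉ F N θ hP).βfun βbar) (k : ℕ) :
    letI := θ.instVβ₁; letI := θ.instVβ₂; letI := θ.instιβ
    beta0OfMerged (betaMerged F (mergedTermFamilyMat F N (chi7 F N θ.toStage8Params) θ.εbg) θ.ρ8 θ.bV) θ.v₀ k = βbar :=
  beta0_record₈_eq_betabar_of_literalB3 θ.toStage8Params S hrem hB3 k

/-- **N28's LITERAL PAIR AT A STAGE-9 DATUM.**  At admissible Stage-9 parameters the packaged literal β-binder of the UV headline,
`T4Continuum.BetaPertHyp` (= (B3) with `0 < β̄` ∧ (B4) with `0 < γc`), holds for the Stage-9 datum's β-functions iff it holds for the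
merged β of record of `θ.toStage8Params`. [cite: Balaban1989LargeFieldII, Thm 1 p.355] -/
theorem betaPertHyp_record₉_iff (θ : Stage9Params F N) (hP : θ.Provisos) (hθ : θ.Admissible) :
    letI := θ.instVβ₁; letI := θ.instVβ₂; letI := θ.instιβ
    BetaPertHyp (datumOfRecord₉ F N θ hP).βfun ↔
      BetaPertHyp (betaMerged F (mergedTermFamilyMat F N (chi7 F N θ.toStage8Params) θ.εbg) θ.ρ8 θ.bV) := by
  rw [βfun_datumOfRecord₉_eq_stage8]
  exact betaPertHyp_record₈_iff θ.toStage8Params hθ.toStage8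

/-- **N28 AT A STAGE-9 RECORD, packaged.**  At a Stage-9 record `(D, w)`: the window `w.γ` is positive; and IF the merged β of record of
every admissible realiser (with its provisos) satisfies the literal pair, so does `D.βfun` — N28's `0 < β̄`, `0 < γc` carried inside
`BetaPertHyp`.  All hypotheses displayed; nothing of Bałaban's β asserted; RIDER №6: nothing is booked over this β.
[cite: Balaban1989LargeFieldII, Thm 1 p.355] -/
theorem betaPertHyp_of_isRecordOfRecord₉C {D : FiniteEpsData F (SU N)} {w : WorldP} (h : IsRecordOfRecord₉C F N D w)
    (hB : ∀ (θ : Stage9Params F N) (hP : θ.Provisos), θ.Admissible → D = datumOfRecord₉ F N θ hP →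
      letI := θ.instVβ₁; letI := θ.instVβ₂; letI := θ.instιβ
      BetaPertHyp (betaMerged F (mergedTermFamilyMat F N (chi7 F N θ.toStage8Params) θ.εbg) θ.ρ8 θ.bV)) :
    0 < w.γ ∧ BetaPertHyp D.βfun := by
  obtain ⟨θ, hP, hθ, hD, -, hw, -, -⟩ := h
  refine ⟨hw.1, ?_⟩
  rw [hD]
  exact (betaPertHyp_record₉_iff θ hP hθ).mpr (hB θ hP hθ hD)

/-! ## §4 The `N = 1` census: at every CHARTED record of `SU(1)` the β of record vanishes genuinely -/

section One

variable {F : T4Family}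

/-- **At `N = 1` a ₈X record's β-functions are the zero family** — genuinely (𝔰𝔲(1) = 0: the chart of record IS the zero chart, so the
β of record vanishes; dag-n23-b's `IsChartOfRecord.betaOfRecord₈_eq_zeroHBeta_of_one` at the witness, whose β IS the datum's).
[cite: Hall2015, Example 7.3; Balaban1987RG1, (1.20)–(1.22) p.264 (bookkeeping at N = 1)] -/
theorem βfun_eq_zeroHBeta_of_isRecordOfRecord₈X_one {D : FiniteEpsData F (SU 1)} {w : WorldP} (h : IsRecordOfRecord₈X F 1 D w) :
    D.βfun = zeroHBeta := by
  obtain ⟨θ, c, -, -, hch, hD, -⟩ := h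
  subst hD
  rw [βfun_stage8]
  exact hch.betaOfRecord₈_eq_zeroHBeta_of_one

/-- **At `N = 1` a ₈R record's β-functions are the zero family** (the record charted BY DEFINITION, `Node00/ChartOfRecord.lean`: its
chart of record `suChartMap 1` is the zero map; via the refinement ₈R → ₈X). [cite: Hall2015, Example 7.3; Balaban1987RG1, (1.20)–(1.22) p.264 (bookkeeping at N = 1)] -/
theorem βfun_eq_zeroHBeta_of_isRecordOfRecord₈R_one {D : FiniteEpsData F (SU 1)} {w : WorldP} (h : IsRecordOfRecord₈R F 1 D w) :
    D.βfun = zeroHBeta :=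
  βfun_eq_zeroHBeta_of_isRecordOfRecord₈X_one (isRecordOfRecord₈X_of_isRecordOfRecord₈R h)

/-- **N28's `0 < β̄` FAILS AT EVERY ₈R RECORD OF `SU(1)`** (LITERAL currency). [cite: Balaban1989LargeFieldII, Thm 1 p.355] -/
theorem not_betaPertHyp_of_isRecordOfRecord₈R_one {D : FiniteEpsData F (SU 1)} {w : WorldP} (h : IsRecordOfRecord₈R F 1 D w) :
    ¬ BetaPertHyp D.βfun := by
  rw [βfun_eq_zeroHBeta_of_isRecordOfRecord₈R_one h]
  exact not_betaPertHyp_zeroHBeta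

/-- **At `N = 1` the Stage-9 β of record is the zero family at every admissible parameter** (admissibility carries a chart of
record; at `N = 1` that chart is zero). [cite: Hall2015, Example 7.3; Balaban1987RG1, (1.20)–(1.22) p.264 (bookkeeping at N = 1)] -/
theorem betaOfRecord₉_eq_zeroHBeta_of_one (θ : Stage9Params F 1) (hθ : θ.Admissible) : betaOfRecord₉ F 1 θ = zeroHBeta :=
  hθ.chart.2.betaOfRecord₈_eq_zeroHBeta_of_one

/-- **At `N = 1` a Stage-9 record's β-functions are the zero family.** [cite: Hall2015, Example 7.3; Balaban1987RG1, (1.20)–(1.22) p.264 (bookkeeping at N = 1)] -/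
theorem βfun_eq_zeroHBeta_of_isRecordOfRecord₉C_one {D : FiniteEpsData F (SU 1)} {w : WorldP} (h : IsRecordOfRecord₉C F 1 D w) :
    D.βfun = zeroHBeta := by
  obtain ⟨θ, hP, hθ, hD, -⟩ := h
  subst hD
  rw [βfun_datumOfRecord₉]
  exact betaOfRecord₉_eq_zeroHBeta_of_one θ hθ

/-- **N28's `0 < β̄` FAILS AT EVERY ₈X RECORD OF `SU(1)`** (LITERAL currency): the packaged literal β-binder `BetaPertHyp D.βfun` is
false — (B3) at the zero family forces `β̄ = 0` (`N28ZeroChart.betaPertH_zeroHBeta_iff`). [cite: Balaban1989LargeFieldII, Thm 1 p.355] -/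
theorem not_betaPertHyp_of_isRecordOfRecord₈X_one {D : FiniteEpsData F (SU 1)} {w : WorldP} (h : IsRecordOfRecord₈X F 1 D w) :
    ¬ BetaPertHyp D.βfun := by
  rw [βfun_eq_zeroHBeta_of_isRecordOfRecord₈X_one h]
  exact not_betaPertHyp_zeroHBeta

/-- **N28's `0 < β̄` FAILS AT EVERY STAGE-9 RECORD OF `SU(1)`** (LITERAL currency). [cite: Balaban1989LargeFieldII, Thm 1 p.355] -/
theorem not_betaPertHyp_of_isRecordOfRecord₉C_one {D : FiniteEpsData F (SU 1)} {w : WorldP} (h : IsRecordOfRecord₉C F 1 D w) :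
    ¬ BetaPertHyp D.βfun := by
  rw [βfun_eq_zeroHBeta_of_isRecordOfRecord₉C_one h]
  exact not_betaPertHyp_zeroHBeta

/-- **N28's B6 CENSUS AT EVERY ₈X RECORD OF `SU(1)`**: N28's `γc`-half with (B4) HOLDS (on every box, in particular with `0 < γc`);
the literal package minus `0 < β̄` HOLDS; every one-loop number of every split is `0`; `BetaAFH` and `BetaPertHyp` FAIL.  At `N = 1`
this is NOT junk: it is what the charted record genuinely says. [cite: Balaban1987RG1, Thm 2 (0.31) p.259 and (2.12)–(2.14) p.268; Balaban1989LargeFieldII, Thm 1 p.355] -/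
theorem b6Census_of_isRecordOfRecord₈X_one {D : FiniteEpsData F (SU 1)} {w : WorldP} (h : IsRecordOfRecord₈X F 1 D w) :
    (∀ γc : ℝ, BetaContH γc D.βfun) ∧ (∃ γc : ℝ, 0 < γc ∧ BetaContH γc D.βfun) ∧
      ((∃ βbar : ℝ, BetaPertH D.βfun βbar) ∧ ∃ γc : ℝ, 0 < γc ∧ BetaContH γc D.βfun) ∧
      (∀ S : B12Beta.OneLoopSplit D.βfun, ∀ k, S.β0 k = 0) ∧ ¬ BetaAFH D.βfun ∧ ¬ BetaPertHyp D.βfun := by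
  rw [βfun_eq_zeroHBeta_of_isRecordOfRecord₈X_one h]
  exact ⟨betaContH_zeroHBeta, ⟨1, one_pos, betaContH_zeroHBeta 1⟩, betaPertHyp_dropSign_zeroHBeta, oneLoopSplit_β0_zeroHBeta,
    not_betaAFH_zeroHBeta, not_betaPertHyp_zeroHBeta⟩

/-- **N28's B6 CENSUS AT EVERY STAGE-9 RECORD OF `SU(1)`** (same five readings). [cite: Balaban1987RG1, Thm 2 (0.31) p.259 and (2.12)–(2.14) p.268; Balaban1989LargeFieldII, Thm 1 p.355] -/
theorem b6Census_of_isRecordOfRecord₉C_one {D : FiniteEpsData F (SU 1)} {w : WorldP} (h : IsRecordOfRecord₉C F 1 D w) :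
    (∀ γc : ℝ, BetaContH γc D.βfun) ∧ (∃ γc : ℝ, 0 < γc ∧ BetaContH γc D.βfun) ∧
      ((∃ βbar : ℝ, BetaPertH D.βfun βbar) ∧ ∃ γc : ℝ, 0 < γc ∧ BetaContH γc D.βfun) ∧
      (∀ S : B12Beta.OneLoopSplit D.βfun, ∀ k, S.β0 k = 0) ∧ ¬ BetaAFH D.βfun ∧ ¬ BetaPertHyp D.βfun := by
  rw [βfun_eq_zeroHBeta_of_isRecordOfRecord₉C_one h]
  exact ⟨betaContH_zeroHBeta, ⟨1, one_pos, betaContH_zeroHBeta 1⟩, betaPertHyp_dropSign_zeroHBeta, oneLoopSplit_β0_zeroHBeta,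
    not_betaAFH_zeroHBeta, not_betaPertHyp_zeroHBeta⟩

/-- **A uniform AF bound — the v0.29-shaped hypothesis `hlo` of `beta0_record₉_pos_of_betaLowerH` — is UNSATISFIABLE at `N = 1`** at
every Stage-9 datum (`0 < b`, non-empty box). [cite: Balaban1987RG1, Thm 2 (0.31) p.259] -/
theorem not_betaLowerH_record₉_of_one (θ : Stage9Params F 1) (hP : θ.Provisos) (hθ : θ.Admissible) {b γ' : ℝ} (hb : 0 < b)
    (hγ' : 0 < γ') : ¬ BetaLowerH b γ' (datumOfRecord₉ F 1 θ hP).βfun := by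
  rw [βfun_datumOfRecord₉, betaOfRecord₉_eq_zeroHBeta_of_one θ hθ, betaLowerH_zeroHBeta_iff hγ']
  exact not_le.mpr hb

variable (F) in
/-- **THE `∃`-FORM OVER THE CHARTED STAGE-8 PREDICATE IS FALSE AT `N = 1`**: no ₈X record of `SU(1)` carries the packaged literal
β-binder.  So the `∃`-form that chair R448 (3) makes countable for `2 ≤ N` is not a claim at `N = 1` at all — the clause `2 ≤ N` is
load-bearing. [cite: Balaban1989LargeFieldII, Thm 1 p.355; Hall2015, Example 7.3] -/
theorem not_exists_isRecordOfRecord₈X_betaPertHyp_one :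
    ¬ ∃ (D : FiniteEpsData F (SU 1)) (w : WorldP), IsRecordOfRecord₈X F 1 D w ∧ BetaPertHyp D.βfun := by
  rintro ⟨D, w, h, hB⟩
  exact not_betaPertHyp_of_isRecordOfRecord₈X_one h hB

variable (F) in
/-- **THE `∃`-FORM OVER THE STAGE-9 PREDICATE IS FALSE AT `N = 1`**: no Stage-9 record of `SU(1)` carries the packaged literal β-binder.
[cite: Balaban1989LargeFieldII, Thm 1 p.355; Hall2015, Example 7.3] -/
theorem not_exists_isRecordOfRecord₉C_betaPertHyp_one :
    ¬ ∃ (D : FiniteEpsData F (SU 1)) (w : WorldP), IsRecordOfRecord₉C F 1 D w ∧ BetaPertHyp D.βfun := by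
  rintro ⟨D, w, h, hB⟩
  exact not_betaPertHyp_of_isRecordOfRecord₉C_one h hB

variable (F) in
/-- … while the `∀`-form of N28's `γc`-half with (B4) HOLDS over both charted predicates at `N = 1` (every box; `γc := 1` displayed) —
the two halves of B6 separate exactly as at the zero chart, but here GENUINELY. [cite: Balaban1987RG1, (1.20)–(1.22) p.264] -/
theorem forall_isRecordOfRecord₈X_₉C_b4_one :
    (∀ (D : FiniteEpsData F (SU 1)) (w : WorldP), IsRecordOfRecord₈X F 1 D w → ∃ γc : ℝ, 0 < γc ∧ BetaContH γc D.βfun) ∧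
      ∀ (D : FiniteEpsData F (SU 1)) (w : WorldP), IsRecordOfRecord₉C F 1 D w → ∃ γc : ℝ, 0 < γc ∧ BetaContH γc D.βfun :=
  ⟨fun _ _ h => (b6Census_of_isRecordOfRecord₈X_one h).2.1, fun _ _ h => (b6Census_of_isRecordOfRecord₉C_one h).2.1⟩

end One

end Summit.QuantumFields.YangMills.BalabanUVNodes.N28AtRecord9
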